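import Mathlib
import HarnessLib
import Summits.HubbardSuperconductivity.HubbardSuperconductivity.Theorems.KLProgrammeKLRegimeTwoVolumeFrameMismatchResum
import Summits.HubbardSuperconductivity.HubbardSuperconductivity.Theorems.KLProgrammeKLRegimeSplitThermalLayer

/-!
# Route `KLProgramme`, crux K3 — engine-flow child (stmt-HubbardSuperconductivity-20437 `KLRegimeEngineV17F2`), stub (C) `stub_twoLeg_curvature`,
# located item #20 «(C)-B-LAST-SIZE», cure (δ) «(C)-LAST-THERMAL» (pen (R111)): the IDENTITY LAYER at the LAST index `N = n_β + 1`
# — the two-frame identity of the fully integrated action is EXACT (no loop, no tree channel)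

Cell gate-hubbard-kl, seat p2 g17.  At the last index `N = nScales β + 1` the scale `Λ_N = klScale klE0 N` lies below the lowest Matsubara frequency
(`klth_klScale_lt_pi_div`: `Λ_N < π/β ≤ |ω_i|`), so the ultraviolet weight of `C^K_{>Λ_N}` is `1` at EVERY `(ω_i, k⃗)` and every frame: the symbol is the bare
resolvent `βL²/(−iω_i + e_K(k⃗))` (§1).  Consequently k3c4-p2's single-scale MISMATCH DEFECT `d = Ψ̃ − Ψ_{K₁}` of `…TwoVolumeFrameMismatchResum` §2 vanishes
IDENTICALLY for any two frames `K₁, K₂` (§2), the near-identity Gaussian step of its §4 is the identity (`effAction_zero_cov`), and the dressed reading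
`klSelfEnergy_frame_eq_chain_add_dressed` (§5 there) collapses to the EXACT two-frame identity (§3 here; `D = K₂ ⊖ K₁`, `κ = D(p_k⃗)/(βL²)`,
`Ψ_j = uvSymbolCT … K_j Λ_N`):

  `Σ_N[K₂](k,σ) = βL²κ − βL²κ²·Ψ₁(k,σ) + (1 − κΨ₁(k,σ))²·Σ_N[K₁](k,σ)`,   i.e. `σ₂ = r·D + r²·σ₁`, `r = 1 − D·C₁ = (1 + D·C₂)⁻¹`,

and, solved for the NATIVE symbol `σ₂ = Σ_N[K₂]` (§4, the form the last-step response door reads; `v := κΨ₂ = D(p_k⃗)/(−iω_i + e_{K₂}(k⃗))`):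

  `Σ_N[K₂] − D(p_k⃗) − Σ_N[K₁] = D(p_k⃗)·v − (2v + v²)·Σ_N[K₂]`.

This is the mechanism of cure (δ) of #20 (memo HOME/p2-g17/LAST-THERMAL-SIZING-p2g17.md §1): the frame change `K_{n_β} → K_N` is done AT SCALE `N`, where it is
exact and carries only the dressing factor `v = O(‖D‖_∞/ω₀)`, and the last slice increment is read in the OLD frame.  Companion files: the real-part /
`±ω₀` bookkeeping and the four-term re-bracketing of `klLocalPart` («SWAP»), then the analytic door for the response.

* §1 `klScale_le_abs_matsubaraFreq_of_nScales_lt`, `sq_klScale_le_of_nScales_lt`, `uvSymbolCT_eq_resolvent_of_nScales_lt` (weight one: the bare resolvent),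
  `ofReal_div_mul_uvSymbolCT_eq_last` (`(x/βL²)·Ψ_K = x/(−iω_i + e_K)`: the dressing parameter `v = κΨ₂ = D/(−iω_i + e_{K₂})`);
* §2 `mismatchDefect_eq_zero_of_nScales_lt` (pointwise), `mismatchDefect_fun_eq_zero_of_nScales_lt`, `normalCovariance_zero_symbol`, `constPart_klEffectiveAction_eq_zero`;
* §3 **`klSelfEnergy_frame_eq_last`** (the exact two-frame identity at scale `N`), `one_sub_mul_one_add_eq_one_last` (`(1 − κΨ₁)(1 + κΨ₂) = 1`);
* §4 **`klSelfEnergy_frame_sub_eq_last_native`** (the response in terms of the native symbol);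
* §5 **`klLocSelfEnergyRe_frame_sub_eq_last_native`** — the READING: `[Re Σ^{sep}_N[K₂] − Re Σ^{sep}_N[K₁]](k⃗) = Re(Dv) − Re b·klLocSelfEnergyRe … K₂ N k⃗ + Im b·ω₀·(1 − klFieldStrength … K₂ N k⃗)`,
  `v = D/(−iω₀ + e_{K₂})`, `b = 2v + v²` (`lastDressing_rev_eq_conj`, `re_mul_add_re_conj_mul`: the real dressing meets the frequency-even data, the imaginary
  dressing only the frequency-ODD data = the field-strength numerator).

Exact identities only (hypotheses: `0 < β`, `nScales β < N`, the two partition functions units — the analyticity lane's standard `hZ`); nothing about sizes is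
asserted; nothing asserts superconductivity.  References: Feldman–Salmhofer–Trubowitz 1996 §1 (the counterterm as a quadratic vertex; resummation);
Benfatto–Giuliani–Mastropietro 2006 §2.2 (2.23), (2.27)–(2.28), (2.38) [cite: BenfattoGiulianiMastropietro2006]; Salmhofer 1999 §2.5.1 (2.106).
-/

noncomputable section

namespace Summit.HubbardSuperconductivity.HubbardSuperconductivity.Theorems.KLRegimeSplit

set_option linter.dupNamespace false -- summit = problem name (single-conjunct summit), D-0017

open Complex Literature.MathematicalPhysics.QuantumLattice Literature.Probability.LatticeModels GrassmannAlgebra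
open Summit.HubbardSuperconductivity.HubbardSuperconductivity.Theorems.KLProgrammeLegKernels
open Summit.HubbardSuperconductivity.HubbardSuperconductivity.Theorems.TwoVolumeDefect

variable {L M : ℕ} [NeZero L]

/-! ## §1 At the last index every Matsubara frequency is above the shell: the symbol is the bare resolvent -/

omit [NeZero L] in
/-- **`Λ_N ≤ |ω_i|` for `N > n_β`**: below the thermal layer nothing is left to integrate (`klth_klScale_lt_pi_div` + `pi_div_le_abs_matsubaraFreq`). -/
theorem klScale_le_abs_matsubaraFreq_of_nScales_lt {β : ℝ} (hβ : 0 < β) {N : ℕ} (hN : nScales β < N) (i : MatsubaraIdx M) :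
    klScale klE0 N ≤ |matsubaraFreq β M i| :=
  (klth_klScale_lt_pi_div hβ hN).le.trans (pi_div_le_abs_matsubaraFreq hβ i)

omit [NeZero L] in
/-- `Λ_N² ≤ ω_i² + e²` for `N > n_β`, any real `e` (the weight-one region of the ultraviolet cutoff). -/
theorem sq_klScale_le_of_nScales_lt {β : ℝ} (hβ : 0 < β) {N : ℕ} (hN : nScales β < N) (i : MatsubaraIdx M) (e : ℝ) :
    klScale klE0 N ^ 2 ≤ matsubaraFreq β M i ^ 2 + e ^ 2 := by
  have h := klScale_le_abs_matsubaraFreq_of_nScales_lt (M := M) hβ hN i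
  have h0 : 0 ≤ klScale klE0 N := (klth_klScale_pos N).le
  calc klScale klE0 N ^ 2 ≤ |matsubaraFreq β M i| ^ 2 := by gcongr
    _ = matsubaraFreq β M i ^ 2 := sq_abs _
    _ ≤ matsubaraFreq β M i ^ 2 + e ^ 2 := le_add_of_nonneg_right (sq_nonneg e)

/-- **At the last index the ultraviolet symbol is the BARE resolvent** `Ψ_K((i,k⃗),σ) = βL²/(−iω_i + e_K(k⃗))` for every frame `K` (weight one everywhere). -/
theorem uvSymbolCT_eq_resolvent_of_nScales_lt {β : ℝ} (hβ : 0 < β) {N : ℕ} (hN : nScales β < N) (μ : ℝ) (K : TrigPolyC4v)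
    (i : MatsubaraIdx M) (kv : TorusSite 2 L) (σ : Fin 2) :
    uvSymbolCT L M β μ K (klScale klE0 N) ((i, kv), σ) =
      ((β * (L : ℝ) ^ 2 : ℝ) : ℂ) / (-I * ((matsubaraFreq β M i : ℝ) : ℂ) + ((nambuXiCT L μ K kv : ℝ) : ℂ)) := by
  rw [uvSymbolCT_eq_uvSymbolFn hβ, uvSymbolFn,
    uvWeightFn_eq_one_of_ge (klth_klScale_pos N) (sq_klScale_le_of_nScales_lt hβ hN i _), resolventFn]
  push_cast
  rw [add_zero, one_mul]

/-- **`(x/(βL²))·Ψ_K((i,k⃗),σ) = x/(−iω_i + e_K(k⃗))`** at the last index, for any real insertion `x` and any frame `K`: with `x = D(p_k⃗)` this is the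
dimensionless dressing parameter `v = κΨ` of the two-frame identity (`|v| ≤ |x|/|ω_i|`). -/
theorem ofReal_div_mul_uvSymbolCT_eq_last {β : ℝ} (hβ : 0 < β) {N : ℕ} (hN : nScales β < N) (μ : ℝ) (K : TrigPolyC4v) (x : ℝ)
    (i : MatsubaraIdx M) (kv : TorusSite 2 L) (σ : Fin 2) :
    (((x / (β * (L : ℝ) ^ 2) : ℝ)) : ℂ) * uvSymbolCT L M β μ K (klScale klE0 N) ((i, kv), σ) =
      ((x : ℝ) : ℂ) / (-I * ((matsubaraFreq β M i : ℝ) : ℂ) + ((nambuXiCT L μ K kv : ℝ) : ℂ)) := by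
  have hL : (L : ℝ) ≠ 0 := by exact_mod_cast NeZero.ne L
  have hz : (-I * ((matsubaraFreq β M i : ℝ) : ℂ) + ((nambuXiCT L μ K kv : ℝ) : ℂ)) ≠ 0 := by
    intro h; have := congrArg Complex.im h; simp at this; exact matsubaraFreq_ne_zero hβ.ne' i this
  rw [uvSymbolCT_eq_resolvent_of_nScales_lt hβ hN μ K i kv σ]
  have hβc : (β : ℂ) ≠ 0 := by exact_mod_cast hβ.ne'
  have hLc : (L : ℂ) ≠ 0 := by exact_mod_cast hL
  push_cast
  field_simp

/-! ## §2 The mismatch defect vanishes identically at the last index -/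

/-- **`d((i,k⃗),σ) = Ψ̃ − Ψ_{K₁} = 0` at scale `N > n_β`**, for ANY two frames (k3c4-p2's `mismatchDefect_eq_zero_of_freq_ge` at every frequency). -/
theorem mismatchDefect_eq_zero_of_nScales_lt {β : ℝ} (hβ : 0 < β) {N : ℕ} (hN : nScales β < N) (μ : ℝ) (K₁ K₂ : TrigPolyC4v)
    (ks : FreqMomentum L M × Fin 2) :
    uvSymbolCT L M β μ K₂ (klScale klE0 N) ks /
          (1 + uvSymbolCT L M β μ K₂ (klScale klE0 N) ks * (((fsub K₂ K₁).eval (latticeMomentum L ks.1.2) / (β * (L : ℝ) ^ 2) : ℝ) : ℂ)) -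
        uvSymbolCT L M β μ K₁ (klScale klE0 N) ks = 0 := by
  obtain ⟨⟨i, kv⟩, σ⟩ := ks
  exact mismatchDefect_eq_zero_of_freq_ge hβ μ K₁ K₂ (klScale klE0 N) (klth_klScale_pos N) i kv σ
    (klScale_le_abs_matsubaraFreq_of_nScales_lt hβ hN i)

/-- The defect SYMBOL is the zero function at the last index. -/
theorem mismatchDefect_fun_eq_zero_of_nScales_lt {β : ℝ} (hβ : 0 < β) {N : ℕ} (hN : nScales β < N) (μ : ℝ) (K₁ K₂ : TrigPolyC4v) :
    (fun ks : FreqMomentum L M × Fin 2 =>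
        uvSymbolCT L M β μ K₂ (klScale klE0 N) ks /
            (1 + uvSymbolCT L M β μ K₂ (klScale klE0 N) ks * (((fsub K₂ K₁).eval (latticeMomentum L ks.1.2) / (β * (L : ℝ) ^ 2) : ℝ) : ℂ)) -
          uvSymbolCT L M β μ K₁ (klScale klE0 N) ks) = fun _ => 0 :=
  funext fun ks => mismatchDefect_eq_zero_of_nScales_lt hβ hN μ K₁ K₂ ks

omit [NeZero L] in
/-- The normal covariance of the zero symbol is the zero matrix. -/
theorem normalCovariance_zero_symbol : normalCovariance L M (fun _ : FreqMomentum L M × Fin 2 => (0 : ℂ)) = 0 := by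
  ext X Y
  rw [normalCovariance_apply, Matrix.zero_apply]
  split_ifs <;> simp

/-- The one-shot action has no constant part (its partition function a unit). -/
theorem constPart_klEffectiveAction_eq_zero {β U μ : ℝ} {K : TrigPolyC4v} {e₀ : ℝ} {n : ℕ}
    (hZ : IsUnit (effPartitionFn ℂ (normalCovariance L M (uvSymbolCT L M β μ K (klScale e₀ n)))
      (hubbardInteraction L M β U + counterQuadratic L M β K))) :
    constPart ℂ (klEffectiveAction L M β U μ K e₀ n) = 0 := by
  rw [klEffectiveAction, hubbardEffectiveActionCT_def, hubbardInteractionCT, hubbardCovAboveCT_zero_seed_eq_normalCovariance_uvSymbolCT]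
  exact constPart_effAction ℂ _ _ hZ

/-! ## §3 The exact two-frame identity at the last index -/

/-- Conjugation of the dressing parameter between the two lowest frequencies: `D/(−i(−ω₀) + e) = conj (D/(−iω₀ + e))` (real `D, e, ω₀`). -/
theorem lastDressing_rev_eq_conj (D e w : ℝ) :
    ((D : ℝ) : ℂ) / (-I * ((-w : ℝ) : ℂ) + ((e : ℝ) : ℂ)) = (starRingEnd ℂ) (((D : ℝ) : ℂ) / (-I * ((w : ℝ) : ℂ) + ((e : ℝ) : ℂ))) := by
  rw [map_div₀, Complex.conj_ofReal, map_add, map_mul, map_neg, Complex.conj_I, Complex.conj_ofReal, Complex.conj_ofReal]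
  push_cast
  ring_nf

/-- Real part of `b·z` plus real part of `conj b · z′`: `= Re b·(Re z + Re z′) − Im b·(Im z − Im z′)` — the `±ω₀` average couples the REAL dressing
to the frequency-even part and the IMAGINARY dressing to the frequency-ODD part only. -/
theorem re_mul_add_re_conj_mul (b z z' : ℂ) :
    (b * z).re + ((starRingEnd ℂ) b * z').re = b.re * (z.re + z'.re) - b.im * (z.im - z'.im) := by
  simp only [Complex.mul_re, Complex.conj_re, Complex.conj_im]
  ring

section Last

variable {β : ℝ} (hβ : 0 < β) (U μ : ℝ) (K₁ K₂ : TrigPolyC4v) {N : ℕ} (hN : nScales β < N)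
  (hZ₂ : IsUnit (effPartitionFn ℂ (normalCovariance L M (uvSymbolCT L M β μ K₂ (klScale klE0 N)))
    (hubbardInteraction L M β U + counterQuadratic L M β K₂)))
  (hZ₁ : IsUnit (effPartitionFn ℂ (normalCovariance L M (uvSymbolCT L M β μ K₁ (klScale klE0 N)))
    (hubbardInteraction L M β U + counterQuadratic L M β K₁)))
include hβ hN hZ₂ hZ₁

/-- **THE EXACT TWO-FRAME IDENTITY AT THE LAST INDEX** (`N > n_β`; `κ = D(p_k⃗)/(βL²)`, `D = K₂ ⊖ K₁`, `Ψ₁ = uvSymbolCT … K₁ Λ_N`):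
`Σ_N[K₂](k,σ) = βL²κ − βL²κ²Ψ₁(k,σ) + (1 − κΨ₁(k,σ))²·Σ_N[K₁](k,σ)` — the dressed reading of k3c4-p2 with the defect `d ≡ 0`: NO covariance response. -/
theorem klSelfEnergy_frame_eq_last (k : FreqMomentum L M) (σ : Fin 2) :
    klSelfEnergy L M β U μ K₂ klE0 N k σ =
      ((β * (L : ℝ) ^ 2 : ℝ) : ℂ) * (((fsub K₂ K₁).eval (latticeMomentum L k.2) / (β * (L : ℝ) ^ 2) : ℝ) : ℂ) -
        ((β * (L : ℝ) ^ 2 : ℝ) : ℂ) * (((fsub K₂ K₁).eval (latticeMomentum L k.2) / (β * (L : ℝ) ^ 2) : ℝ) : ℂ) ^ 2 *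
          uvSymbolCT L M β μ K₁ (klScale klE0 N) (k, σ) +
        (1 - (((fsub K₂ K₁).eval (latticeMomentum L k.2) / (β * (L : ℝ) ^ 2) : ℝ) : ℂ) * uvSymbolCT L M β μ K₁ (klScale klE0 N) (k, σ)) ^ 2 *
          klSelfEnergy L M β U μ K₁ klE0 N k σ := by
  have hk := mismatchDefect_eq_zero_of_nScales_lt hβ hN μ K₁ K₂ (k, σ)
  rw [sub_eq_zero] at hk
  have hV0 : constPart ℂ (klEffectiveAction L M β U μ K₁ klE0 N) = 0 := constPart_klEffectiveAction_eq_zero hZ₁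
  rw [klSelfEnergy_frame_eq_chain_add_dressed hβ U μ K₁ K₂ klE0 N hZ₂ hZ₁ k σ, mismatchDefect_fun_eq_zero_of_nScales_lt hβ hN μ K₁ K₂,
    normalCovariance_zero_symbol, effAction_zero_cov ℂ _ hV0]
  simp only at hk
  rw [hk]
  rfl

omit hZ₂ hZ₁ in
/-- **`(1 − κΨ₁)·(1 + κΨ₂) = 1` at the last index**: the two dressing factors are inverse to each other (`Ψ_j = βL²/(−iω + e_{K_j})`,
`e_{K₂} = e_{K₁} − D(p_k⃗)`). -/
theorem one_sub_mul_one_add_eq_one_last (k : FreqMomentum L M) (σ : Fin 2) :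
    (1 - (((fsub K₂ K₁).eval (latticeMomentum L k.2) / (β * (L : ℝ) ^ 2) : ℝ) : ℂ) * uvSymbolCT L M β μ K₁ (klScale klE0 N) (k, σ)) *
        (1 + (((fsub K₂ K₁).eval (latticeMomentum L k.2) / (β * (L : ℝ) ^ 2) : ℝ) : ℂ) * uvSymbolCT L M β μ K₂ (klScale klE0 N) (k, σ)) = 1 := by
  obtain ⟨i, kv⟩ := k
  have hω : matsubaraFreq β M i ≠ 0 := matsubaraFreq_ne_zero hβ.ne' i
  have he₂ : nambuXiCT L μ K₂ kv = nambuXiCT L μ K₁ kv - (fsub K₂ K₁).eval (latticeMomentum L kv) :=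
    nambuXiCT_eq_sub_eval_fsub (L := L) μ K₁ K₂ kv
  show (1 - (((fsub K₂ K₁).eval (latticeMomentum L kv) / (β * (L : ℝ) ^ 2) : ℝ) : ℂ) * uvSymbolCT L M β μ K₁ (klScale klE0 N) ((i, kv), σ)) *
      (1 + (((fsub K₂ K₁).eval (latticeMomentum L kv) / (β * (L : ℝ) ^ 2) : ℝ) : ℂ) * uvSymbolCT L M β μ K₂ (klScale klE0 N) ((i, kv), σ)) = 1
  rw [ofReal_div_mul_uvSymbolCT_eq_last hβ hN μ K₁ _ i kv σ, ofReal_div_mul_uvSymbolCT_eq_last hβ hN μ K₂ _ i kv σ, he₂]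
  set z₁ : ℂ := -I * ((matsubaraFreq β M i : ℝ) : ℂ) + ((nambuXiCT L μ K₁ kv : ℝ) : ℂ) with hz₁def
  set Dc : ℂ := (((fsub K₂ K₁).eval (latticeMomentum L kv) : ℝ) : ℂ) with hDc
  have hz₁ : z₁ ≠ 0 := by
    intro h; have := congrArg Complex.im h; simp [hz₁def] at this; exact hω this
  have hz₂ : z₁ - Dc ≠ 0 := by
    intro h; have := congrArg Complex.im h; simp [hz₁def, hDc] at this; exact hω this
  have hden : -I * ((matsubaraFreq β M i : ℝ) : ℂ) + (((nambuXiCT L μ K₁ kv - (fsub K₂ K₁).eval (latticeMomentum L kv) : ℝ)) : ℂ) = z₁ - Dc := by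
    rw [hz₁def, hDc]; push_cast; ring
  rw [hden]
  field_simp
  ring

/-! ## §4 The response in terms of the NATIVE symbol `Σ_N[K₂]` -/

/-- **THE LAST-STEP RESPONSE IN NATIVE FORM**: with `v := κΨ₂(k,σ) = D(p_k⃗)/(−iω + e_{K₂}(k⃗))`,
`Σ_N[K₂](k,σ) − D(p_k⃗) − Σ_N[K₁](k,σ) = D(p_k⃗)·v − (2v + v²)·Σ_N[K₂](k,σ)` — the frame response of the `K`-separated symbol at the fully integrated
scale is an explicit dressing of the NATIVE symbol, small like `‖D‖_∞/ω₀` (no loop, no tree channel). -/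
theorem klSelfEnergy_frame_sub_eq_last_native (k : FreqMomentum L M) (σ : Fin 2) :
    klSelfEnergy L M β U μ K₂ klE0 N k σ - (((fsub K₂ K₁).eval (latticeMomentum L k.2) : ℝ) : ℂ) - klSelfEnergy L M β U μ K₁ klE0 N k σ =
      (((fsub K₂ K₁).eval (latticeMomentum L k.2) : ℝ) : ℂ) *
          ((((fsub K₂ K₁).eval (latticeMomentum L k.2) / (β * (L : ℝ) ^ 2) : ℝ) : ℂ) * uvSymbolCT L M β μ K₂ (klScale klE0 N) (k, σ)) -
        (2 * ((((fsub K₂ K₁).eval (latticeMomentum L k.2) / (β * (L : ℝ) ^ 2) : ℝ) : ℂ) * uvSymbolCT L M β μ K₂ (klScale klE0 N) (k, σ)) +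
            ((((fsub K₂ K₁).eval (latticeMomentum L k.2) / (β * (L : ℝ) ^ 2) : ℝ) : ℂ) * uvSymbolCT L M β μ K₂ (klScale klE0 N) (k, σ)) ^ 2) *
          klSelfEnergy L M β U μ K₂ klE0 N k σ := by
  have hS := klSelfEnergy_frame_eq_last hβ U μ K₁ K₂ hN hZ₂ hZ₁ k σ
  have h1 := one_sub_mul_one_add_eq_one_last hβ μ K₁ K₂ hN k σ
  have hL : (0 : ℝ) < L := by exact_mod_cast NeZero.pos L
  have hc0 : β * (L : ℝ) ^ 2 ≠ 0 := by positivity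
  -- abbreviations
  set c : ℂ := ((β * (L : ℝ) ^ 2 : ℝ) : ℂ) with hc
  set κ : ℂ := (((fsub K₂ K₁).eval (latticeMomentum L k.2) / (β * (L : ℝ) ^ 2) : ℝ) : ℂ) with hκ
  set Dc : ℂ := (((fsub K₂ K₁).eval (latticeMomentum L k.2) : ℝ) : ℂ) with hDc
  set P₁ : ℂ := uvSymbolCT L M β μ K₁ (klScale klE0 N) (k, σ) with hP₁
  set P₂ : ℂ := uvSymbolCT L M β μ K₂ (klScale klE0 N) (k, σ) with hP₂
  set S₁ : ℂ := klSelfEnergy L M β U μ K₁ klE0 N k σ with hS₁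
  set S₂ : ℂ := klSelfEnergy L M β U μ K₂ klE0 N k σ with hS₂
  have hβc : (β : ℂ) ≠ 0 := by exact_mod_cast hβ.ne'
  have hLc : (L : ℂ) ≠ 0 := by exact_mod_cast hL.ne'
  have hcκ : c * κ = Dc := by
    rw [hc, hκ, hDc]; push_cast; field_simp
  -- `S₂ = cκ − cκ·(κP₁) + (1 − κP₁)² S₁` and `(1 − κP₁)(1 + κP₂) = 1`
  have hS' : S₂ = Dc - Dc * (κ * P₁) + (1 - κ * P₁) ^ 2 * S₁ := by
    rw [hS, ← hcκ]; ring
  linear_combination (1 + κ * P₂) ^ 2 * hS' + (Dc * (1 + κ * P₂) + S₁ * ((1 - κ * P₁) * (1 + κ * P₂) + 1)) * h1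

/-! ## §5 The READING of the response: real parts at `±ω₀`, spin average — native data only -/

/-- **THE LAST-STEP RESPONSE DATA IN NATIVE READING CURRENCY (odd-average form).**  With `D = (K₂ ⊖ K₁)(p_k⃗)`, `e = e_{K₂}(k⃗)`, `ω₀ = π/β`, the dressing
parameter `v = D/(−iω₀ + e)` and `b = 2v + v²`:
`klLocSelfEnergyRe … K₂ N k⃗ − D − klLocSelfEnergyRe … K₁ N k⃗ = Re(D·v) − Re b · klLocSelfEnergyRe … K₂ N k⃗ + Im b · ¼Σ_σ[Im Σ_N[K₂](ω₀,k⃗,σ) − Im Σ_N[K₂](−ω₀,k⃗,σ)]`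
— the real dressing meets the NATIVE cumulative reading data (frame part included), the imaginary dressing only the frequency-ODD part. -/
theorem klLocSelfEnergyRe_frame_sub_eq_last_native [NeZero M] (kv : TorusSite 2 L) :
    klLocSelfEnergyRe L M β U μ K₂ N kv - (fsub K₂ K₁).eval (latticeMomentum L kv) - klLocSelfEnergyRe L M β U μ K₁ N kv =
      ((((fsub K₂ K₁).eval (latticeMomentum L kv) : ℝ) : ℂ) *
            ((((fsub K₂ K₁).eval (latticeMomentum L kv) : ℝ) : ℂ) / (-I * ((Real.pi / β : ℝ) : ℂ) + ((nambuXiCT L μ K₂ kv : ℝ) : ℂ)))).re -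
        (2 * ((((fsub K₂ K₁).eval (latticeMomentum L kv) : ℝ) : ℂ) / (-I * ((Real.pi / β : ℝ) : ℂ) + ((nambuXiCT L μ K₂ kv : ℝ) : ℂ))) +
              ((((fsub K₂ K₁).eval (latticeMomentum L kv) : ℝ) : ℂ) / (-I * ((Real.pi / β : ℝ) : ℂ) + ((nambuXiCT L μ K₂ kv : ℝ) : ℂ))) ^ 2).re *
          klLocSelfEnergyRe L M β U μ K₂ N kv +
        (2 * ((((fsub K₂ K₁).eval (latticeMomentum L kv) : ℝ) : ℂ) / (-I * ((Real.pi / β : ℝ) : ℂ) + ((nambuXiCT L μ K₂ kv : ℝ) : ℂ))) +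
              ((((fsub K₂ K₁).eval (latticeMomentum L kv) : ℝ) : ℂ) / (-I * ((Real.pi / β : ℝ) : ℂ) + ((nambuXiCT L μ K₂ kv : ℝ) : ℂ))) ^ 2).im *
          ((∑ σ : Fin 2, ((klSelfEnergy L M β U μ K₂ klE0 N (omega0 M, kv) σ).im -
              (klSelfEnergy L M β U μ K₂ klE0 N ((omega0 M).rev, kv) σ).im)) / 4) := by
  -- abbreviations
  set D : ℝ := (fsub K₂ K₁).eval (latticeMomentum L kv) with hD
  set e : ℝ := nambuXiCT L μ K₂ kv with he
  set w : ℝ := Real.pi / β with hw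
  set v : ℂ := ((D : ℝ) : ℂ) / (-I * ((w : ℝ) : ℂ) + ((e : ℝ) : ℂ)) with hv
  set b : ℂ := 2 * v + v ^ 2 with hb
  have hω₀ : matsubaraFreq β M (omega0 M) = w := matsubaraFreq_omega0 M β
  have hω₁ : matsubaraFreq β M (omega0 M).rev = -w := matsubaraFreq_omega0_rev M β
  -- the native identity at the two lowest frequencies, per spin, with the dressing parameter made explicit
  have key : ∀ (i : MatsubaraIdx M) (σ : Fin 2),
      klSelfEnergy L M β U μ K₂ klE0 N (i, kv) σ - ((D : ℝ) : ℂ) - klSelfEnergy L M β U μ K₁ klE0 N (i, kv) σ =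
        ((D : ℝ) : ℂ) * (((D : ℝ) : ℂ) / (-I * ((matsubaraFreq β M i : ℝ) : ℂ) + ((e : ℝ) : ℂ))) -
          (2 * (((D : ℝ) : ℂ) / (-I * ((matsubaraFreq β M i : ℝ) : ℂ) + ((e : ℝ) : ℂ))) +
              (((D : ℝ) : ℂ) / (-I * ((matsubaraFreq β M i : ℝ) : ℂ) + ((e : ℝ) : ℂ))) ^ 2) *
            klSelfEnergy L M β U μ K₂ klE0 N (i, kv) σ := by
    intro i σ
    have h := klSelfEnergy_frame_sub_eq_last_native hβ U μ K₁ K₂ hN hZ₂ hZ₁ (i, kv) σ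
    have hvi := ofReal_div_mul_uvSymbolCT_eq_last hβ hN μ K₂ D i kv σ
    simp only at h hvi
    rw [hvi] at h
    exact h
  have hplus : ∀ σ : Fin 2,
      klSelfEnergy L M β U μ K₂ klE0 N (omega0 M, kv) σ - ((D : ℝ) : ℂ) - klSelfEnergy L M β U μ K₁ klE0 N (omega0 M, kv) σ =
        ((D : ℝ) : ℂ) * v - b * klSelfEnergy L M β U μ K₂ klE0 N (omega0 M, kv) σ := by
    intro σ; rw [key, hω₀]
  have hminus : ∀ σ : Fin 2,
      klSelfEnergy L M β U μ K₂ klE0 N ((omega0 M).rev, kv) σ - ((D : ℝ) : ℂ) - klSelfEnergy L M β U μ K₁ klE0 N ((omega0 M).rev, kv) σ =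
        ((D : ℝ) : ℂ) * (starRingEnd ℂ) v - (starRingEnd ℂ) b * klSelfEnergy L M β U μ K₂ klE0 N ((omega0 M).rev, kv) σ := by
    intro σ
    rw [key, hω₁, lastDressing_rev_eq_conj D e w]
    rw [hb, map_add, map_mul, map_pow, map_ofNat]
  -- real parts per spin: even coupling of `Re b`, odd coupling of `Im b`
  have hre : ∀ σ : Fin 2,
      ((klSelfEnergy L M β U μ K₂ klE0 N (omega0 M, kv) σ).re - D - (klSelfEnergy L M β U μ K₁ klE0 N (omega0 M, kv) σ).re) +
        ((klSelfEnergy L M β U μ K₂ klE0 N ((omega0 M).rev, kv) σ).re - D -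
          (klSelfEnergy L M β U μ K₁ klE0 N ((omega0 M).rev, kv) σ).re) =
        2 * (((D : ℝ) : ℂ) * v).re -
          (b.re * ((klSelfEnergy L M β U μ K₂ klE0 N (omega0 M, kv) σ).re + (klSelfEnergy L M β U μ K₂ klE0 N ((omega0 M).rev, kv) σ).re) -
            b.im * ((klSelfEnergy L M β U μ K₂ klE0 N (omega0 M, kv) σ).im - (klSelfEnergy L M β U μ K₂ klE0 N ((omega0 M).rev, kv) σ).im)) := by
    intro σ
    have h1 := congrArg Complex.re (hplus σ)
    have h2 := congrArg Complex.re (hminus σ)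
    have h3 := re_mul_add_re_conj_mul b (klSelfEnergy L M β U μ K₂ klE0 N (omega0 M, kv) σ)
      (klSelfEnergy L M β U μ K₂ klE0 N ((omega0 M).rev, kv) σ)
    have h4 : (((D : ℝ) : ℂ) * (starRingEnd ℂ) v).re = (((D : ℝ) : ℂ) * v).re := by
      simp only [Complex.mul_re, Complex.conj_re, Complex.conj_im, Complex.ofReal_re, Complex.ofReal_im]; ring
    simp only [Complex.sub_re, Complex.ofReal_re] at h1 h2
    rw [h4] at h2
    linarith [h1, h2, h3]
  -- assemble the spin/frequency average
  have h0 := hre 0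
  have h1 := hre 1
  unfold klLocSelfEnergyRe
  rw [Fin.sum_univ_two, Fin.sum_univ_two, Fin.sum_univ_two]
  linear_combination (1 / 4 : ℝ) * (h0 + h1)


end Last

/-- **The odd average IS the field-strength numerator**: `¼Σ_σ[Im Σ_N[K](ω₀,k⃗,σ) − Im Σ_N[K](−ω₀,k⃗,σ)] = (π/β)·(1 − klFieldStrength … K N k⃗)`
(`fieldStrengthSpin = 1 − (Im Σ(ω₀) − Im Σ(−ω₀))/(2ω₀)`, spin-averaged) — so the class-#7 TIME row / the (E3d) field-strength clause at `(K_N, N)`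
(`|z − 1| ≤ Zt·U²` at every momentum) is exactly what sizes the imaginary dressing. -/
theorem quarter_sum_im_sub_eq_mul_one_sub_klFieldStrength [NeZero M] {β : ℝ} (hβ0 : β ≠ 0) (U μ : ℝ) (K : TrigPolyC4v) (N : ℕ) (kv : TorusSite 2 L) :
    (∑ σ : Fin 2, ((klSelfEnergy L M β U μ K klE0 N (omega0 M, kv) σ).im - (klSelfEnergy L M β U μ K klE0 N ((omega0 M).rev, kv) σ).im)) / 4 =
      (Real.pi / β) * (1 - klFieldStrength L M β U μ K N kv) := by
  have hw : Real.pi / β ≠ 0 := div_ne_zero Real.pi_ne_zero hβ0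
  unfold klFieldStrength
  rw [fieldStrength, fieldStrengthSpin, fieldStrengthSpin, Fin.sum_univ_two]
  simp only [klSelfEnergy]
  field_simp
  ring


end Summit.HubbardSuperconductivity.HubbardSuperconductivity.Theorems.KLRegimeSplit

end
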